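import Summits.Ventures.PercRepro.Night2TwoOneKernel
import Summits.Ventures.PercRepro.Night2TwoOneFloorsB
import Summits.Ventures.PercRepro.Night2TwoOneMass
import Summits.Ventures.PercRepro.Night2TwoOneAllFat

/-!
# PercRepro — **THE CELL `(2, 1)` WITH TWO FAT CLOSURES IN ITS SPREAD REGIME** (night-2, gen 28)

The two-fat-closure clause of the `(2, 1)` nested residue of the `(7, 5)` shadow row, at every `|V| ≥ 9`, when every
thin member misses `2` or `≥ 7` points and there are at most two fat closures: (LI_G) holds.  Meeting missed pairs: the
cell is lossless (`Night2TwoOneLossless`).  Disjoint missed pairs: the hybrid rule with `P` = the big members and the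
COMPLETION shares along the four off-plane points — every lossy big pair has two completion targets
(`two_fat_faces_of_loss_ne_zero`, `card_sdiff_classes_eq_two`), the column bound (`dload_comp_two_one_le_cap2`), and
the basis pairs' fair-share inequality from the count along the plane (`pi2MassH_le_plane_two_one`), the profile
floors (`cap3_ge_vTwoOne`) and the kernel sums with their tail (`qSumW_twoOne_ge_one`) through
`basis_pair_fair_of_qSumW_two_one`.

* **`localShadowHall_two_one_five_two_fat_disjoint`**, **`localShadowHall_two_one_five_two_fat`**: the cell through
  two given fat members; **`localShadowHall_two_one_five_fatClosures`**: in the residue vocabulary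
  (`2 ≤ #fatClosures ≤ 2`, the spread hypothesis, `|V| ≥ 9`).
-/

namespace PercRepro.Shadow

open Finset PerFlat ThmH

variable {α : Type*} [DecidableEq α] {M : Matroid α} [M.Finite]

section Cell

variable {G : Finset α}

open scoped Classical in
/-- **THE CELL WITH DISJOINT MISSED PAIRS** (`|V| ≥ 9`, spread regime, at most two fat closures). -/
theorem localShadowHall_two_one_five_two_fat_disjoint (hG : G ∈ flatsQ M (5 + 1)) (hd : (gr M \ G).card = 2)
    (hk : kColoops M G = 1) (hs : ∀ e ∈ gr M, ∀ f ∈ gr M, e ≠ f → rkN M {e, f} = 2)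
    (hl : ∀ e ∈ gr M, M.Indep {e}) (h9 : 9 ≤ (G \ coloops M G).card)
    {B₀ B₁ : Finset α} (hB₀ : B₀ ∈ thinMembers M 5 G) (hB₁ : B₁ ∈ thinMembers M 5 G)
    (hm₀ : (G \ clF M B₀).card ≤ 2) (hm₁ : (G \ clF M B₁).card ≤ 2) (hne : clF M B₀ ≠ clF M B₁)
    (hfat : (fatClosures M 5 G 2).card ≤ 2)
    (hsp : ∀ B ∈ thinMembers M 5 G, 2 < (G \ clF M B).card → 7 ≤ (G \ clF M B).card)
    (hdisj : Disjoint (G \ clF M B₀) (G \ clF M B₁)) : LocalShadowHall M 5 G := by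
  have hd' : (gr M \ G).card ≤ 5 := by omega
  have hk' : kColoops M G + 5 = 5 + 1 := by omega
  have hGg : G ⊆ gr M := (mem_flatsQ.1 hG).1
  have hKH₀ : coloops M G ⊆ clF M B₀ := (coloops_subset_of_mem_thinMembers hG hd' hB₀).trans
    (subset_clF (mem_membersIn.1 (mem_thinMembers.1 hB₀).1).1)
  have hKH₁ : coloops M G ⊆ clF M B₁ := (coloops_subset_of_mem_thinMembers hG hd' hB₁).trans
    (subset_clF (mem_membersIn.1 (mem_thinMembers.1 hB₁).1).1)
  have hH₀G : clF M B₀ ⊆ G := (mem_membersIn.1 (mem_thinMembers.1 hB₀).1).2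
  have hA2 : (G \ clF M B₀).card = 2 := by
    have := two_le_card_sdiff_of_not_lay0 hG hd' (mem_thinMembers.1 hB₀).1 (mem_thinMembers.1 hB₀).2
    omega
  have hB2 : (G \ clF M B₁).card = 2 := by
    have := two_le_card_sdiff_of_not_lay0 hG hd' (mem_thinMembers.1 hB₁).1 (mem_thinMembers.1 hB₁).2
    omega
  set Xs := (G \ clF M B₀) ∪ (G \ clF M B₁) with hXs
  set P := (clF M B₀ ∩ clF M B₁) \ coloops M G with hPdef
  set n := (G \ coloops M G).card with hn
  have hXG : Xs ⊆ G := Finset.union_subset Finset.sdiff_subset Finset.sdiff_subset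
  have hXs4 : Xs.card = 4 := by rw [hXs, Finset.card_union_of_disjoint hdisj, hA2, hB2]
  have hPV : P ⊆ G \ coloops M G :=
    Finset.sdiff_subset_sdiff (Finset.inter_subset_left.trans hH₀G) (Finset.Subset.refl _)
  have hVP : (G \ coloops M G) \ P = Xs := by
    ext x
    constructor
    · intro hx
      rw [Finset.mem_sdiff, Finset.mem_sdiff] at hx
      exact mem_classes_of_notMem_plane hx.1.1 hx.1.2 hx.2
    · intro hx
      rw [Finset.mem_sdiff, Finset.mem_sdiff]
      rw [hXs, Finset.mem_union, Finset.mem_sdiff, Finset.mem_sdiff] at hx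
      rcases hx with h | h
      · exact ⟨⟨h.1, fun hK => h.2 (hKH₀ hK)⟩, fun hP => h.2 (Finset.mem_inter.1 (Finset.mem_sdiff.1 hP).1).1⟩
      · exact ⟨⟨h.1, fun hK => h.2 (hKH₁ hK)⟩, fun hP => h.2 (Finset.mem_inter.1 (Finset.mem_sdiff.1 hP).1).2⟩
  have hPcard : P.card = n - 4 := by
    have := Finset.card_sdiff_add_card_eq_card hPV
    rw [hVP, hXs4] at this
    omega
  have hdl := dload_comp_two_one_le_cap2 hG hd hk hs hl hB₀ hB₁ hm₀ hm₁ hne hfat hsp hdisj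
  apply localShadowHall_of_comp (P := fun B => 5 ≤ (B \ coloops M G).card) hG hd' hXG
  · -- every lossy big pair has a completion target
    intro B hB hbig z hz hl0
    obtain ⟨-, u, huQ, u', hu'Q, huu', hFu, hclu, hFu', hclu'⟩ :=
      two_fat_faces_of_loss_ne_zero hG hd hk hs hl hB₀ hB₁ hm₀ hm₁ hne hfat hsp hB hbig hz hl0
    have hQG : insert z B ⊆ G := Finset.insert_subset (Finset.mem_sdiff.1 hz).1
      ((subset_clF (mem_membersIn.1 (mem_thinMembers.1 hB).1).1).trans (mem_membersIn.1 (mem_thinMembers.1 hB).1).2)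
    have hQ6 : rkN M (insert z B) = 6 := rkN_insert_eq_six_of_thin hG hB hz
    have hsub₀ : (insert z B).erase u ⊆ clF M B₀ := by
      rw [← hclu]; exact subset_clF (mem_membersIn.1 (mem_thinMembers.1 hFu).1).1
    have hsub₁ : (insert z B).erase u' ⊆ clF M B₁ := by
      rw [← hclu']; exact subset_clF (mem_membersIn.1 (mem_thinMembers.1 hFu').1).1
    have h₀ := inter_missed_eq_singleton hQG hQ6
      (rkN_clF_eq_five_of_mem_Uq (mem_membersIn.1 (mem_thinMembers.1 hB₀).1).1).le huQ hsub₀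
    have h₁ := inter_missed_eq_singleton hQG hQ6
      (rkN_clF_eq_five_of_mem_Uq (mem_membersIn.1 (mem_thinMembers.1 hB₁).1).1).le hu'Q hsub₁
    have hc := card_sdiff_classes_eq_two hdisj hA2 hB2 h₀ h₁
    rw [← hXs] at hc
    rw [← Finset.card_pos, hc]
    norm_num
  · exact hdl
  · -- the basis pairs' inequality
    intro B hB hnP z hz
    by_cases hl0 : loss M 5 G B z = 0
    · rw [hl0]
      exact mul_nonneg (rhoL_nonneg hG hd' B z) (lossIncomeH_nonneg hG hd' hdl B z)
    · have hB4 : (B \ coloops M G).card + 1 = 5 := by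
        have := card_sdiff_coloops_thin_ge hG hd' hk' hB
        omega
      obtain ⟨hXP3, hXP2, -, -, -⟩ :=
        profile_of_lossy_basis_pair hG hd hk hB₀ hB₁ hm₀ hm₁ hne hdisj hB hB4 hz hl0
      have hprof : profileAt (coloops M G) P (insert z B) = (3, 2) := by
        simp only [profileAt]
        rw [hXP3, hXP2]
      apply basis_pair_fair_of_qSumW_two_one hG hd hk (by omega) hPV (cnt := cntTwoOne) (vTwoOne_nonneg n)
        (eTwoOne_pos (by omega : 3 ≤ n)) hdl hB hnP hz hl0
      · intro T hT
        have := pi2MassH_le_plane_two_one hG hd hk hs hl h9 hB₀ hB₁ hm₀ hm₁ hne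
          (subset_G_of_mem_shadowAt (mem_tgtSets.1 hT).1)
        exact this
      · exact cap3_ge_vTwoOne hG hd hk hs hl hB₀ hB₁ hm₀ hm₁ hne hfat hsp hdisj hB hB4 hz hl0
      · rw [hprof, hVP, hXs4, hPcard]
        exact qSumW_twoOne_ge_one h9

open scoped Classical in
/-- **THE CELL `(2, 1)` WITH TWO FAT CLOSURES IN ITS SPREAD REGIME** (`|V| ≥ 9`). -/
theorem localShadowHall_two_one_five_two_fat (hG : G ∈ flatsQ M (5 + 1)) (hd : (gr M \ G).card = 2)
    (hk : kColoops M G = 1) (hs : ∀ e ∈ gr M, ∀ f ∈ gr M, e ≠ f → rkN M {e, f} = 2)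
    (hl : ∀ e ∈ gr M, M.Indep {e}) (h9 : 9 ≤ (G \ coloops M G).card)
    {B₀ B₁ : Finset α} (hB₀ : B₀ ∈ thinMembers M 5 G) (hB₁ : B₁ ∈ thinMembers M 5 G)
    (hm₀ : (G \ clF M B₀).card ≤ 2) (hm₁ : (G \ clF M B₁).card ≤ 2) (hne : clF M B₀ ≠ clF M B₁)
    (hfat : (fatClosures M 5 G 2).card ≤ 2)
    (hsp : ∀ B ∈ thinMembers M 5 G, 2 < (G \ clF M B).card → 7 ≤ (G \ clF M B).card) :
    LocalShadowHall M 5 G := by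
  by_cases hdisj : Disjoint (G \ clF M B₀) (G \ clF M B₁)
  · exact localShadowHall_two_one_five_two_fat_disjoint hG hd hk hs hl h9 hB₀ hB₁ hm₀ hm₁ hne hfat hsp hdisj
  · exact localShadowHall_two_one_five_two_fat_meet hG hd hk hB₀ hB₁ hm₀ hm₁ hne hdisj

open scoped Classical in
/-- **THE CELL IN THE RESIDUE VOCABULARY**: exactly two fat closures and the spread hypothesis, at every `|V|`
(`|V| ≤ 8` is lossless, `Night2TwoOneAllFat`). -/
theorem localShadowHall_two_one_five_fatClosures (hG : G ∈ flatsQ M (5 + 1)) (hd : (gr M \ G).card = 2)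
    (hk : kColoops M G = 1) (hs : ∀ e ∈ gr M, ∀ f ∈ gr M, e ≠ f → rkN M {e, f} = 2)
    (hl : ∀ e ∈ gr M, M.Indep {e})
    (h2 : 2 ≤ (fatClosures M 5 G 2).card) (hfat : (fatClosures M 5 G 2).card ≤ 2)
    (hsp : ∀ B ∈ thinMembers M 5 G, 2 < (G \ clF M B).card → 7 ≤ (G \ clF M B).card) :
    LocalShadowHall M 5 G := by
  obtain ⟨H₀, hH₀, H₁, hH₁, hne⟩ := Finset.one_lt_card.1 (by omega : 1 < (fatClosures M 5 G 2).card)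
  unfold fatClosures at hH₀ hH₁
  obtain ⟨B₀, hB₀, rfl⟩ := Finset.mem_image.1 hH₀
  obtain ⟨B₁, hB₁, rfl⟩ := Finset.mem_image.1 hH₁
  rw [Finset.mem_filter] at hB₀ hB₁
  rcases Nat.lt_or_ge (G \ coloops M G).card 9 with h8 | h9
  · exact localShadowHall_two_one_five_small hG hd hk hB₀.1 hB₁.1 hB₀.2 hB₁.2 hne hfat hsp (by omega)
  · exact localShadowHall_two_one_five_two_fat hG hd hk hs hl h9 hB₀.1 hB₁.1 hB₀.2 hB₁.2 hne hfat hsp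

end Cell

end PercRepro.Shadow
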